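import Mathlib
import Summits.Parity.BatemanHorn.Theorems.IsogenyRedeiSplitBlockJacobiSmoothing
import Summits.Parity.BatemanHorn.Theorems.IsogenyRedeiSplitBlockJacobiSmoothCutoff
import Summits.Parity.BatemanHorn.Theorems.IsogenyRedeiSplitBlockJacobiShell
import Summits.Parity.BatemanHorn.Theorems.IsogenyRedeiSplitBlockJacobiShellCount
import Summits.Parity.BatemanHorn.Theorems.IsogenyRedeiSplitBlockJacobiCells
import Summits.Parity.BatemanHorn.Theorems.IsogenyRedeiSplitBlockJacobiPoissonBulk
import Summits.Parity.BatemanHorn.Theorems.IsogenyRedeiSplitBlockJacobiPoissonMaster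
import HarnessLib

/-!
# The master inequality at a fixed `x` (helper toward `stub_poissonReduction`, line
`cofactor-root-discrepancy`, crux `SplitBlockJacobi`, stmt-Parity-11583)

`abs_Dbulk_le_master`: for fixed `x` satisfying explicit size conditions, the smoothing parameters
`k, L`, the grid fineness `T` and the number of grid steps `I`, the bulk discrepancy
`D^{bulk}_{θ,μ}(x) = Σ_{bulk} (Q|Q′)(A_{QQ′}(x) − 4x/(QQ′))` satisfies

`|D^{bulk}| ≤ 219 k L + I² (48672 x^{1−ε₀+3ε₀/8} + 4 x^{2−μ} (x^{1−ε₀/8})^{k+1}/L^k)`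
`        + C₁ (√(2/T) x + x^μ + 1) + 16 x (1 + log x)/T + 8 x^μ`,

given the tier Weyl bound AT `x` (hypothesis) and the shell-mass constant `C₁`. Assembly of
`smoothing_error_le` (F2), the cell decomposition, `good_cell_bound` (F4) and the shell estimates.
-/

noncomputable section

open Finset

namespace Summit.Parity.BatemanHorn.Cruxes.SplitBlockJacobi.CofactorRootDiscrepancy.Poisson

/-- The cutoff polynomial `(Σ_{M < s ≤ N} X^s) · (Σ_{j < L} X^j)^k ∈ ℕ[X]` (local notation). -/
local notation3 "cutoffPoly[" M ", " N ", " L ", " k "]" =>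
  ((∑ s ∈ Finset.Ioc M N, (Polynomial.X : Polynomial ℕ) ^ s) *
    (∑ j ∈ Finset.range L, (Polynomial.X : Polynomial ℕ) ^ j) ^ k)

/-- The root Weyl sum `S(h, q)` (local notation; literally the skeleton's `rootWeylSum h q`). -/
local notation3 (prettyPrint := false) "rWS[" h "](" q ")" =>
  (∑ ν ∈ (Finset.range (q : ℕ)).filter (fun ν : ℕ => (q : ℕ) ∣ ν ^ 2 + 1),
    Complex.exp (2 * Real.pi * Complex.I * ((h : ℤ) : ℂ) * ((ν : ℕ) : ℂ) / ((q : ℕ) : ℂ)))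

/-- The twisted root Weyl sum over `(a, m] × (b, n]` (local notation; literally the skeleton's
`twistedSum h a m b n`). -/
local notation3 (prettyPrint := false) "tS[" h "](" a ", " m ", " b ", " n ")" =>
  (∑ Q ∈ (Finset.Ioc (a : ℕ) m).filter (fun Q : ℕ => Q.Prime ∧ Q % 4 = 1),
    ∑ Q' ∈ (Finset.Ioc (b : ℕ) n).filter (fun Q' : ℕ => Q'.Prime ∧ Q' % 4 = 1),
      ((jacobiSym (Q : ℤ) Q' : ℤ) : ℂ) * rWS[h](Q * Q'))

/-- The bulk pair set of the line at height `X` (local notation). -/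
local notation3 (prettyPrint := false) "bulkSet[" θ ", " x ", " X "]" =>
  (((Finset.range ((x : ℕ) ^ 2 + 2) ×ˢ Finset.range ((x : ℕ) ^ 2 + 2)).filter (fun q : ℕ × ℕ =>
    q.1.Prime ∧ q.2.Prime ∧ q.1 % 4 = 1 ∧ q.2 % 4 = 1 ∧ ((x : ℕ) : ℝ) ^ (θ : ℝ) < (q.1 : ℝ) ∧
      q.1 < q.2 ∧ q.1 * q.2 ≤ (x : ℕ) ^ 2 + 1)).filter
    (fun q : ℕ × ℕ => ((q.1 * q.2 : ℕ) : ℝ) ≤ (X : ℝ)))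

/-! ### Small lemmas -/

/-- `|u − v| ≤ U + V` for `0 ≤ u ≤ U`, `0 ≤ v ≤ V`. -/
theorem abs_sub_le_add_of_nonneg {u v U V : ℝ} (hu0 : 0 ≤ u) (huU : u ≤ U) (hv0 : 0 ≤ v)
    (hvV : v ≤ V) : |u - v| ≤ U + V := by
  rw [abs_sub_le_iff]; constructor <;> linarith

/-- The bad set of the cutoff has at most `3kL` elements. -/
theorem card_bad_le (x k L : ℕ) :
    ((Finset.Icc 1 x).filter (fun t : ℕ => t < k * L + 1 + k * (L - 1) ∨ x - k * L < t)).card ≤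
      3 * (k * L) := by
  have hsub : (Finset.Icc 1 x).filter (fun t : ℕ => t < k * L + 1 + k * (L - 1) ∨ x - k * L < t) ⊆
      Finset.Icc 1 (k * L + k * (L - 1)) ∪ Finset.Ioc (x - k * L) x := by
    intro t ht
    rw [Finset.mem_filter, Finset.mem_Icc] at ht
    rw [Finset.mem_union, Finset.mem_Icc, Finset.mem_Ioc]
    omega
  refine (Finset.card_le_card hsub).trans ((Finset.card_union_le _ _).trans ?_)
  rw [Nat.card_Icc, Nat.card_Ioc]
  have : k * (L - 1) ≤ k * L := Nat.mul_le_mul_left k (Nat.sub_le L 1)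
  omega

/-- `x² / x^{2−μ} = x^μ` for `x > 0`. -/
theorem sq_div_rpow_two_sub {x : ℝ} (hx : 0 < x) (μ : ℝ) : x ^ 2 / x ^ (2 - μ) = x ^ μ := by
  rw [div_eq_iff (Real.rpow_pos_of_pos hx _).ne', ← Real.rpow_natCast,
    ← Real.rpow_add hx]
  norm_num

/-! ### The master inequality -/

set_option maxHeartbeats 400000 in
/-- **The master inequality at a fixed `x`.** See the module docstring; `hC₁` is the shell-mass
property (`shell_mass_le`), `hTWx` the tier Weyl bound at `x`; the grid is
`g_i = ⌊x^θ (1 + 1/T)^i⌋` and `hI` says that `I` steps reach height `x² + 2`. -/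
theorem abs_Dbulk_le_master (θ μ ε₀ : ℝ) (hθ : 1 / 2 < θ) (hθ1 : θ < 1) (hμ0 : 0 < μ)
    (hμ1 : μ < 1) (hε₀ : 0 < ε₀) (C₁ : ℝ)
    (hC₁ : ∀ (x : ℕ) (X δ' : ℝ), 1 ≤ x → (x : ℝ) ≤ X → 0 < δ' → δ' ≤ 1 / 2 →
      ∀ P : Finset (ℕ × ℕ), (∀ q ∈ P, q.1.Prime ∧ q.2.Prime ∧ q.1 < q.2 ∧
        X * (1 - δ') < ((q.1 * q.2 : ℕ) : ℝ) ∧ ((q.1 * q.2 : ℕ) : ℝ) ≤ X) →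
      ∑ q ∈ P, ((((Finset.Icc 1 x).filter (fun t : ℕ => q.1 * q.2 ∣ t ^ 2 + 1)).card : ℕ) : ℝ) ≤
        C₁ * (Real.sqrt δ' * x + (x : ℝ) ^ 2 / X + 1))
    (x k L T I : ℕ) (hx2 : 2 ≤ x) (hlog : (32 : ℝ) ≤ Real.log x) (hL : 1 ≤ L) (hkL : k * L ≤ x)
    (hT : 4 ≤ T) (hx16 : (16 : ℝ) ≤ (x : ℝ) ^ (1 - ε₀ / 8))
    (hx4 : (4 : ℝ) ≤ (x : ℝ) ^ (ε₀ - ε₀ / 8)) (hxθ3 : (3 : ℝ) ≤ (x : ℝ) ^ θ)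
    (hg0x : x ≤ ⌊(x : ℝ) ^ θ⌋₊ * ⌊(x : ℝ) ^ θ⌋₊)
    (hI : x ^ 2 + 2 ≤ ⌊(x : ℝ) ^ θ * (1 + 1 / (T : ℝ)) ^ I⌋₊)
    (hTWx : ∀ P₁ P₁' P₂ P₂' : ℕ, (x : ℝ) ^ θ ≤ 2 * (P₁ : ℝ) → P₁ ≤ P₁' → P₁' ≤ 2 * P₁ →
      P₁ ≤ P₂ → P₂ ≤ P₂' → P₂' ≤ 2 * P₂ → ((P₁ * P₂ : ℕ) : ℝ) ≤ (x : ℝ) ^ (2 - μ) →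
      ∀ h : ℤ, h ≠ 0 → |(h : ℝ)| ≤ ((P₁ * P₂ : ℕ) : ℝ) * (x : ℝ) ^ (ε₀ - 1) →
        ‖tS[h](P₁, P₁', P₂, P₂')‖ ≤ (x : ℝ) ^ (1 - ε₀)) :
    |∑ q ∈ bulkSet[θ, x, (x : ℝ) ^ (2 - μ)], (jacobiSym (q.1 : ℤ) q.2 : ℝ) *
        (((((Finset.Icc 1 x).filter (fun t : ℕ => q.1 * q.2 ∣ t ^ 2 + 1)).card : ℕ) : ℝ) -
          4 * (x : ℝ) / ((q.1 * q.2 : ℕ) : ℝ))| ≤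
      219 * ((k * L : ℕ) : ℝ) +
        (I : ℝ) ^ 2 * (48672 * (x : ℝ) ^ (1 - ε₀ + 3 * (ε₀ / 8)) +
          4 * (x : ℝ) ^ (2 - μ) * ((x : ℝ) ^ (1 - ε₀ / 8)) ^ (k + 1) / (L : ℝ) ^ k) +
        (C₁ * (Real.sqrt (2 / (T : ℝ)) * x + (x : ℝ) ^ μ + 1) +
          (16 * x * (1 + Real.log x) / T + 8 * (x : ℝ) ^ μ)) := by
  -- ### Step 0: notation and basic facts
  have hx1 : 1 ≤ x := by omega
  have hxR : (0 : ℝ) < x := by exact_mod_cast (show 0 < x by omega)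
  have hxR1 : (1 : ℝ) ≤ x := by exact_mod_cast hx1
  have hT2 : 2 ≤ T := by omega
  have hT0 : (0 : ℝ) < T := by exact_mod_cast (show 0 < T by omega)
  set X : ℝ := (x : ℝ) ^ (2 - μ) with hX
  have hX0 : 0 < X := Real.rpow_pos_of_pos hxR _
  have hXx2 : X ≤ (x : ℝ) ^ 2 := by
    rw [hX, ← Real.rpow_natCast]
    exact Real.rpow_le_rpow_of_exponent_le hxR1 (by push_cast; linarith)
  have hxX : (x : ℝ) ≤ X := by
    rw [hX]
    conv_lhs => rw [← Real.rpow_one (x : ℝ)]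
    exact Real.rpow_le_rpow_of_exponent_le hxR1 (by linarith)
  have hxμ : (x : ℝ) ^ 2 / X = (x : ℝ) ^ μ := by rw [hX]; exact sq_div_rpow_two_sub hxR μ
  -- the grid
  set g : ℕ → ℕ := fun i => ⌊(x : ℝ) ^ θ * (1 + 1 / (T : ℝ)) ^ i⌋₊ with hg_def
  have hy0 : (0 : ℝ) ≤ (x : ℝ) ^ θ := by positivity
  have hr1 : (1 : ℝ) ≤ 1 + 1 / (T : ℝ) := le_add_of_nonneg_right (by positivity)
  have hgmono : Monotone g := grid_mono hy0 hr1
  have hg0 : g 0 = ⌊(x : ℝ) ^ θ⌋₊ := by simp [hg_def]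
  have hg2 : ∀ i, g (i + 1) ≤ 2 * g i := fun i => grid_succ_le_two_mul hxθ3 hT2 i
  have hgx : x ≤ g 0 * g 0 := by rw [hg0]; exact hg0x
  have hgI : x ^ 2 + 2 ≤ g I := hI
  -- the weight
  set M : ℕ := k * L with hM
  set N : ℕ := x - k * L with hN
  have hL0 : 0 < L := hL
  have hxw : N + k * (L - 1) ≤ x := by
    have : k * (L - 1) ≤ k * L := Nat.mul_le_mul_left k (Nat.sub_le L 1)
    omega
  set w : ℕ → ℝ := fun t => (((cutoffPoly[M, N, L, k]).coeff t : ℕ) : ℝ) / (L : ℝ) ^ k with hw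
  obtain ⟨hw0, hw1, hWx⟩ := sum_cutoff_weight_le M N L k x hL0
  set W : ℝ := ∑ t ∈ Finset.Icc 1 x, w t with hW
  have hW0 : 0 ≤ W := Finset.sum_nonneg fun t _ => hw0 t
  set Bset := (Finset.Icc 1 x).filter (fun t : ℕ => t < k * L + 1 + k * (L - 1) ∨ x - k * L < t)
    with hBset
  have hBsub : Bset ⊆ Finset.Icc 1 x := Finset.filter_subset _ _
  have hwB : ∀ t ∈ Finset.Icc 1 x, t ∉ Bset → w t = 1 := by
    intro t ht htB
    rw [hBset, Finset.mem_filter, not_and_or] at htB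
    rcases htB with h | h
    · exact absurd ht h
    · push Not at h
      have hc := coeff_cutoff_eq M N L k t hL0 (by rw [hM]; omega) (by rw [hN]; omega)
      rw [hw]
      simp only [hc, Nat.cast_pow]
      exact div_self (by positivity)
  have hBcard : (Bset.card : ℝ) ≤ 3 * ((k * L : ℕ) : ℝ) := by
    exact_mod_cast card_bad_le x k L
  -- the bulk set and its members
  set Pb := bulkSet[θ, x, X] with hPb
  have hmemPb : ∀ q ∈ Pb, q.1.Prime ∧ q.2.Prime ∧ q.1 % 4 = 1 ∧ q.2 % 4 = 1 ∧
      (x : ℝ) ^ θ < (q.1 : ℝ) ∧ q.1 < q.2 := by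
    intro q hq
    have h := (mem_bulk_iff θ x X q).mp hq
    exact ⟨h.2.1.1, h.2.1.2.1, h.2.1.2.2.1, h.2.1.2.2.2.1, h.2.1.2.2.2.2.1, h.2.1.2.2.2.2.2.1⟩
  -- ### Step 1: smoothing (F2)
  have hP25 : ∀ t ∈ Finset.Icc 1 x, (Pb.filter (fun q : ℕ × ℕ => q.1 * q.2 ∣ t ^ 2 + 1)).card ≤ 25 := by
    intro t ht
    refine card_filter_mul_dvd_le hθ hx2 Pb (fun q hq => ?_) t ht
    obtain ⟨h1, h2, -, -, hθq, hlt⟩ := hmemPb q hq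
    exact ⟨h1, h2, hθq, hlt⟩
  have hP0 : ∀ q ∈ Pb, 0 < q.1 * q.2 := by
    intro q hq
    obtain ⟨h1, h2, -⟩ := hmemPb q hq
    exact Nat.mul_pos h1.pos h2.pos
  have hF2 := smoothing_error_le x 25 Pb hP25 hP0 (fun q => (jacobiSym (q.1 : ℤ) q.2 : ℝ))
    (fun q _ => abs_jacobiSym_le_one q.1 q.2) w hw0 hw1 Bset hBsub hwB
  have hinv : ∑ q ∈ Pb, (1 : ℝ) / ((q.1 * q.2 : ℕ) : ℝ) ≤ 12 := by
    refine le_trans (Finset.sum_le_sum_of_subset_of_nonneg (Finset.filter_subset _ _)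
      fun q _ _ => by positivity) ?_
    exact sum_pairs_inv_le hθ hθ1 hlog
  have hF2' : |(∑ q ∈ Pb, (jacobiSym (q.1 : ℤ) q.2 : ℝ) *
        (((((Finset.Icc 1 x).filter (fun t : ℕ => q.1 * q.2 ∣ t ^ 2 + 1)).card : ℕ) : ℝ) -
          4 * (x : ℝ) / ((q.1 * q.2 : ℕ) : ℝ))) -
      ∑ q ∈ Pb, (jacobiSym (q.1 : ℤ) q.2 : ℝ) *
        ((∑ t ∈ (Finset.Icc 1 x).filter (fun t : ℕ => q.1 * q.2 ∣ t ^ 2 + 1), w t) -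
          4 * W / ((q.1 * q.2 : ℕ) : ℝ))| ≤ 219 * ((k * L : ℕ) : ℝ) := by
    refine hF2.trans ?_
    calc (Bset.card : ℝ) * ((25 : ℕ) + 4 * ∑ q ∈ Pb, (1 : ℝ) / ((q.1 * q.2 : ℕ) : ℝ))
        ≤ (3 * ((k * L : ℕ) : ℝ)) * ((25 : ℕ) + 4 * 12) := by
          refine mul_le_mul hBcard (by rw [Nat.cast_ofNat]; linarith [hinv]) (by positivity)
            (by positivity)
      _ = 219 * ((k * L : ℕ) : ℝ) := by push_cast; ring
  -- ### Step 2: the cell decomposition of the smoothed sum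
  set F : ℕ × ℕ → ℝ := fun q => (jacobiSym (q.1 : ℤ) q.2 : ℝ) *
    ((∑ t ∈ (Finset.Icc 1 x).filter (fun t : ℕ => q.1 * q.2 ∣ t ^ 2 + 1), w t) -
      4 * W / ((q.1 * q.2 : ℕ) : ℝ)) with hF
  set S := (Finset.range I ×ˢ Finset.range I).filter
    (fun ij : ℕ × ℕ => ((g (ij.1 + 1) * g (ij.2 + 1) : ℕ) : ℝ) ≤ X) with hS
  have hdec := sum_eq_sum_cells_add_sum_sdiff Pb hgmono S F
  -- the uniform cell bound
  set cellU : ℝ := 48672 * (x : ℝ) ^ (1 - ε₀ + 3 * (ε₀ / 8)) +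
    4 * X * ((x : ℝ) ^ (1 - ε₀ / 8)) ^ (k + 1) / (L : ℝ) ^ k with hcellU
  have hcellU0 : 0 ≤ cellU := by rw [hcellU]; positivity
  have hcells : ∀ ij ∈ S, |∑ q ∈ Pb.filter (fun q : ℕ × ℕ =>
      q.1 ∈ Finset.Ioc (g ij.1) (g (ij.1 + 1)) ∧ q.2 ∈ Finset.Ioc (g ij.2) (g (ij.2 + 1))), F q| ≤
      cellU := by
    intro ij hij
    rw [hS, Finset.mem_filter] at hij
    obtain ⟨-, hgood⟩ := hij
    obtain ⟨i, j⟩ := ij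
    simp only at hgood ⊢
    rcases Nat.lt_trichotomy i j with hlt | heq | hgt
    · rw [hPb, bulk_cell_eq_rect θ x hXx2 hgmono hg0 hlt hgood]
      exact good_cell_bound θ μ ε₀ x M N L k hε₀ hL0 hxw hx1 hx16 hx4 (by linarith) hgmono hg0
        hg2 hgx hTWx hlt.le hgood
    · subst heq
      rw [hPb, bulk_cell_diag_eq θ x hXx2 hgmono hg0 hgood]
      have hhalf := sum_diag_jacobi_eq_half (Finset.Ioc (g i) (g (i + 1)))
        (fun n : ℕ => (∑ t ∈ (Finset.Icc 1 x).filter (fun t : ℕ => n ∣ t ^ 2 + 1), w t) -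
          4 * W / ((n : ℕ) : ℝ))
      simp only [hF] at hhalf ⊢
      rw [hhalf, abs_mul, abs_of_pos (by norm_num : (0 : ℝ) < 1 / 2)]
      have hgc := good_cell_bound θ μ ε₀ x M N L k hε₀ hL0 hxw hx1 hx16 hx4 (by linarith) hgmono hg0
        hg2 hgx hTWx le_rfl hgood
      refine le_trans ?_ hgc
      refine le_trans ?_ (le_of_eq (one_mul _))
      exact mul_le_mul_of_nonneg_right (by norm_num) (abs_nonneg _)
    · rw [hPb, bulk_cell_eq_empty θ x X hgmono hgt, Finset.sum_empty, abs_zero]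
      exact hcellU0
  have hScard : (S.card : ℝ) ≤ (I : ℝ) ^ 2 := by
    have h := Finset.card_filter_le (Finset.range I ×ˢ Finset.range I)
      (fun ij : ℕ × ℕ => ((g (ij.1 + 1) * g (ij.2 + 1) : ℕ) : ℝ) ≤ X)
    rw [Finset.card_product, Finset.card_range] at h
    have : ((S.card : ℕ) : ℝ) ≤ ((I * I : ℕ) : ℝ) := by exact_mod_cast h
    rw [sq]; push_cast at this; exact this
  have hcellsum : |∑ ij ∈ S, ∑ q ∈ Pb.filter (fun q : ℕ × ℕ =>
      q.1 ∈ Finset.Ioc (g ij.1) (g (ij.1 + 1)) ∧ q.2 ∈ Finset.Ioc (g ij.2) (g (ij.2 + 1))), F q| ≤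
      (I : ℝ) ^ 2 * cellU := by
    refine (Finset.abs_sum_le_sum_abs _ _).trans ((Finset.sum_le_sum hcells).trans ?_)
    rw [Finset.sum_const, nsmul_eq_mul]
    exact mul_le_mul_of_nonneg_right hScard hcellU0
  -- ### Step 3: the shell
  set Rest := Pb \ S.biUnion (fun ij : ℕ × ℕ => Pb.filter (fun q : ℕ × ℕ =>
      q.1 ∈ Finset.Ioc (g ij.1) (g (ij.1 + 1)) ∧ q.2 ∈ Finset.Ioc (g ij.2) (g (ij.2 + 1))))
    with hRest
  set δ' : ℝ := 2 / (T : ℝ) with hδ'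
  have hδ0 : 0 < δ' := by rw [hδ']; positivity
  have hδ2 : δ' ≤ 1 / 2 := by
    rw [hδ', div_le_iff₀ hT0]
    have : (4 : ℝ) ≤ T := by exact_mod_cast hT
    linarith
  have hRestmem : ∀ q ∈ Rest, q.1.Prime ∧ q.2.Prime ∧ q.1 < q.2 ∧ 1 ≤ q.1 ∧ q.1 ≤ x ∧
      X * (1 - δ') < ((q.1 * q.2 : ℕ) : ℝ) ∧ ((q.1 * q.2 : ℕ) : ℝ) ≤ X := by
    intro q hq
    obtain ⟨h1, h2, hlt, h11, h1x, hqX, i, j, -, -, hci, hcj, hbad⟩ :=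
      mem_bad_cell_of_mem_sdiff θ x X hg0 hgI hq
    refine ⟨h1, h2, hlt, h11, h1x, ?_, hqX⟩
    rw [hδ']
    exact shell_of_bad_cell hy0 hX0.le hT2 hci hcj hbad
  have hRestF : ∀ q ∈ Rest, |F q| ≤
      ((((Finset.Icc 1 x).filter (fun t : ℕ => q.1 * q.2 ∣ t ^ 2 + 1)).card : ℕ) : ℝ) +
        4 * x * ((1 : ℝ) / ((q.1 * q.2 : ℕ) : ℝ)) := by
    intro q hq
    obtain ⟨h1, h2, -⟩ := hRestmem q hq
    have hq0 : (0 : ℝ) < ((q.1 * q.2 : ℕ) : ℝ) := by exact_mod_cast Nat.mul_pos h1.pos h2.pos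
    rw [hF]
    simp only
    rw [abs_mul]
    refine le_trans (mul_le_of_le_one_left (abs_nonneg _) (abs_jacobiSym_le_one q.1 q.2)) ?_
    refine abs_sub_le_add_of_nonneg (Finset.sum_nonneg fun t _ => hw0 t) ?_ (by positivity) ?_
    · calc ∑ t ∈ (Finset.Icc 1 x).filter (fun t : ℕ => q.1 * q.2 ∣ t ^ 2 + 1), w t
          ≤ ∑ t ∈ (Finset.Icc 1 x).filter (fun t : ℕ => q.1 * q.2 ∣ t ^ 2 + 1), (1 : ℝ) :=
            Finset.sum_le_sum fun t _ => hw1 t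
        _ = _ := by simp
    · rw [mul_one_div]
      exact div_le_div_of_nonneg_right (by linarith) hq0.le
  have hshell1 := hC₁ x X δ' hx1 hxX hδ0 hδ2 Rest (fun q hq => by
    obtain ⟨h1, h2, hlt, -, -, hlo, hhi⟩ := hRestmem q hq
    exact ⟨h1, h2, hlt, hlo, hhi⟩)
  have hshell2 := sum_shell_inv_le x hx1 hX0 hδ0.le hδ2 Rest (fun q hq => by
    obtain ⟨-, -, -, h11, h1x, hlo, hhi⟩ := hRestmem q hq
    exact ⟨h11, h1x, hlo, hhi⟩)
  have hsqrt : Real.sqrt δ' = Real.sqrt (2 / (T : ℝ)) := by rw [hδ']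
  have hrestsum : |∑ q ∈ Rest, F q| ≤ C₁ * (Real.sqrt (2 / (T : ℝ)) * x + (x : ℝ) ^ μ + 1) +
      (16 * x * (1 + Real.log x) / T + 8 * (x : ℝ) ^ μ) := by
    refine (Finset.abs_sum_le_sum_abs _ _).trans ((Finset.sum_le_sum hRestF).trans ?_)
    rw [Finset.sum_add_distrib, ← Finset.mul_sum]
    refine add_le_add ?_ ?_
    · rw [← hsqrt, ← hxμ]; exact hshell1
    · calc 4 * (x : ℝ) * ∑ q ∈ Rest, (1 : ℝ) / ((q.1 * q.2 : ℕ) : ℝ)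
          ≤ 4 * (x : ℝ) * (2 * δ' * (1 + Real.log x) + 2 * x / X) :=
            mul_le_mul_of_nonneg_left hshell2 (by positivity)
        _ = 16 * x * (1 + Real.log x) / T + 8 * ((x : ℝ) ^ 2 / X) := by
            rw [hδ']; field_simp; ring
        _ = 16 * x * (1 + Real.log x) / T + 8 * (x : ℝ) ^ μ := by rw [hxμ]
  -- ### Step 4: assembly
  have hsmooth : |∑ q ∈ Pb, F q| ≤ (I : ℝ) ^ 2 * cellU +
      (C₁ * (Real.sqrt (2 / (T : ℝ)) * x + (x : ℝ) ^ μ + 1) +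
        (16 * x * (1 + Real.log x) / T + 8 * (x : ℝ) ^ μ)) := by
    rw [hdec]
    exact (abs_add_le _ _).trans (add_le_add hcellsum hrestsum)
  have htri := abs_sub_abs_le_abs_sub (∑ q ∈ Pb, (jacobiSym (q.1 : ℤ) q.2 : ℝ) *
        (((((Finset.Icc 1 x).filter (fun t : ℕ => q.1 * q.2 ∣ t ^ 2 + 1)).card : ℕ) : ℝ) -
          4 * (x : ℝ) / ((q.1 * q.2 : ℕ) : ℝ))) (∑ q ∈ Pb, F q)
  rw [hcellU] at hsmooth
  linarith [hF2', hsmooth, htri]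

end Summit.Parity.BatemanHorn.Cruxes.SplitBlockJacobi.CofactorRootDiscrepancy.Poisson

namespace Summit.Parity.BatemanHorn.Cruxes.SplitBlockJacobi.CofactorRootDiscrepancy

/-- **Registered stub form** of `Poisson.abs_Dbulk_le_master`: the identical statement, declared in the crux
namespace under the name registered on stmt-Parity-11583 (`ledger workitem stub-add`). -/
theorem abs_Dbulk_le_master :
    ∀ (θ μ ε₀ : ℝ) (hθ : 1 / 2 < θ) (hθ1 : θ < 1) (hμ0 : 0 < μ) (hμ1 : μ < 1) (hε₀ : 0 < ε₀) (C₁ : ℝ) (hC₁ : ∀ (x : ℕ) (X δ' : ℝ), 1 ≤ x → (x : ℝ) ≤ X → 0 < δ' → δ' ≤ 1 / 2 → ∀ P : Finset (ℕ × ℕ), (∀ q ∈ P, q.1.Prime ∧ q.2.Prime ∧ q.1 < q.2 ∧ X * (1 - δ') < ((q.1 * q.2 : ℕ) : ℝ) ∧ ((q.1 * q.2 : ℕ) : ℝ) ≤ X) → ∑ q ∈ P, ((((Finset.Icc 1 x).filter (fun t : ℕ => q.1 * q.2 ∣ t ^ 2 + 1)).card : ℕ) : ℝ) ≤ C₁ *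 (Real.sqrt δ' * x + (x : ℝ) ^ 2 / X + 1)) (x k L T I : ℕ) (hx2 : 2 ≤ x) (hlog : (32 : ℝ) ≤ Real.log x) (hL : 1 ≤ L) (hkL : k * L ≤ x) (hT : 4 ≤ T) (hx16 : (16 : ℝ) ≤ (x : ℝ) ^ (1 - ε₀ / 8)) (hx4 : (4 : ℝ) ≤ (x : ℝ) ^ (ε₀ - ε₀ / 8)) (hxθ3 : (3 : ℝ) ≤ (x : ℝ) ^ θ) (hg0x : x ≤ ⌊(x : ℝ) ^ θ⌋₊ * ⌊(x : ℝ) ^ θ⌋₊) (hI : x ^ 2 + 2 ≤ ⌊(x : ℝ) ^ θ * (1 + 1 / (T : ℝ)) ^ I⌋₊) (hTWx : ∀ P₁ P₁' P₂ P₂' : ℕ, (x : ℝ) ^ θ ≤ 2 * (P₁ : ℝ) → P₁ ≤ P₁' → P₁' ≤ 2 * P₁ → P₁ ≤ P₂ → P₂ ≤ P₂' → P₂' ≤ 2 * P₂ → ((P₁ * P₂ : ℕ) : ℝ) ≤ (x : ℝ) ^ (2 - μ) → ∀ h : ℤ, h ≠ 0 → |(h : ℝ)| ≤ ((P₁ *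 P₂ : ℕ) : ℝ) * (x : ℝ) ^ (ε₀ - 1) → ‖(∑ Q ∈ (Finset.Ioc (P₁ : ℕ) P₁').filter (fun Q : ℕ => Q.Prime ∧ Q % 4 = 1), ∑ Q' ∈ (Finset.Ioc (P₂ : ℕ) P₂').filter (fun Q' : ℕ => Q'.Prime ∧ Q' % 4 = 1), ((jacobiSym (Q : ℤ) Q' : ℤ) : ℂ) * (∑ ν ∈ (Finset.range (Q * Q' : ℕ)).filter (fun ν : ℕ => (Q * Q' : ℕ) ∣ ν ^ 2 + 1), Complex.exp (2 * Real.pi * Complex.I * ((h : ℤ) : ℂ) * ((ν : ℕ) : ℂ) / ((Q * Q' : ℕ) : ℂ))))‖ ≤ (x : ℝ) ^ (1 - ε₀)), |∑ q ∈ (((Finset.range ((x : ℕ) ^ 2 + 2) ×ˢ Finset.range ((x : ℕ) ^ 2 + 2)).filter (fun q : ℕ × ℕ => q.1.Prime ∧ q.2.Prime ∧ q.1 % 4 = 1 ∧ q.2 % 4 = 1 ∧ ((x : ℕ) : ℝ) ^ (θ : ℝ) < (q.1 : ℝ) ∧ q.1 < q.2 ∧ q.1 * q.2 ≤ (x : ℕ)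 ^ 2 + 1)).filter (fun q : ℕ × ℕ => ((q.1 * q.2 : ℕ) : ℝ) ≤ ((x : ℝ) ^ (2 - μ) : ℝ))), (jacobiSym (q.1 : ℤ) q.2 : ℝ) * (((((Finset.Icc 1 x).filter (fun t : ℕ => q.1 * q.2 ∣ t ^ 2 + 1)).card : ℕ) : ℝ) - 4 * (x : ℝ) / ((q.1 * q.2 : ℕ) : ℝ))| ≤ 219 * ((k * L : ℕ) : ℝ) + (I : ℝ) ^ 2 * (48672 * (x : ℝ) ^ (1 - ε₀ + 3 * (ε₀ / 8)) + 4 * (x : ℝ) ^ (2 - μ) * ((x : ℝ) ^ (1 - ε₀ / 8)) ^ (k + 1) / (L : ℝ) ^ k) + (C₁ * (Real.sqrt (2 / (T : ℝ)) * x + (x : ℝ) ^ μ + 1) + (16 * x * (1 + Real.log x) / T + 8 * (x : ℝ) ^ μ)) :=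
  @Poisson.abs_Dbulk_le_master

end Summit.Parity.BatemanHorn.Cruxes.SplitBlockJacobi.CofactorRootDiscrepancy

end
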